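import Literature.RingTheory.OrderOfVanishing.LengthDeterminant
import Mathlib.LinearAlgebra.Determinant
import Mathlib.LinearAlgebra.FiniteDimensional.Defs
import HarnessLib

/-!
# Lattices and determinants: `d(M, φM) = ord_A(det φ)` (Stacks 02MI, Fulton Lemma A.3)

Let `A` be a Noetherian domain of Krull dimension `≤ 1` with fraction field `K`, `V` a
finite-dimensional `K`-vector space and `M ⊆ V` a *lattice*: a finitely generated `A`-submodule
spanning `V` over `K` (Stacks, Algebra, Definition 10.121.3 = Tag 02ME).  For a `K`-linear
`φ : V → V` with `φ(M) ⊆ M` and `det φ ≠ 0` we prove that `ℓ_A(M / φM)` is finite and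
`ord_A(det φ) = ℓ_A(M / φM)`
(`Literature.RingTheory.OrderOfVanishing.ordFrac_det_eq_length_quotient`), where
`ord_A : K^* → ℤ` is Mathlib's `Ring.ordFrac A` (Stacks Tag 02MD).  This is Stacks, Algebra,
Lemma 10.121.7 (Tag 02MI), `d(M, φ(M)) = ord_A(det φ)`, in the case `φ(M) ⊆ M` where the distance
`d(M, φM)` (Tag 02MG) is the plain length `ℓ_A(M/φM)`; equivalently Fulton, *Intersection Theory*,
Lemma A.3 (`e_A(φ, M) = ord_A(det φ_K)`) for torsion-free `M` and injective `φ`.  (Stacks states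
02MI for `A` local; locality is not used.)  It is the input for `ord_A(Nm f) = Σ [κ(𝔪ᵢ):κ] ord(f)`
(Tag 02MJ) and thereby for Stacks Tag 02RT
(`Literature.AlgebraicGeometry.Motives.map_div_eq_div_norm`).
Everything here is proved; there are no definitions and no named facts.

## Proof (Fulton, Lemma A.3)

Choose a `K`-basis `b` of `V` inside `M` and let `F = ⊕ A bᵢ ≤ M` be the free lattice it spans;
`c • M ⊆ F` for a common denominator `c ≠ 0`, so `ℓ(M/F) < ∞`.  For an injective endomorphism
`ψ` with `ψF ⊆ F`, `ψM ⊆ M` one has `ℓ(M/ψM) = ℓ(F/ψF)` (compute `ℓ(M/ψF)` along `ψF ≤ ψM ≤ M` and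
along `ψF ≤ F ≤ M`,
`Literature.RingTheory.OrderOfVanishing.length_subquotient_map_eq_of_le`).  With `a ≠ 0` a
denominator of the matrix of `φ` in the basis `b`, apply this to `ψ = aφ` and to `ψ = a`:
`ℓ(F/aφF) = ord_A(det_F(aφ))` and `ℓ(F/aF) = ord_A(aⁿ)` by Fulton's Lemma A.2.6
(`Literature.RingTheory.OrderOfVanishing.length_quotient_range_eq_ord_det`),
`ℓ(M/aφM) = ℓ(M/aM) + ℓ(M/φM)` (Lemma A.2.5), and `det_F(aφ) = aⁿ det φ` in `K`.

## Main results

* `Literature.RingTheory.OrderOfVanishing.length_subquotient_add`,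
  `Literature.RingTheory.OrderOfVanishing.length_subquotient_map`,
  `Literature.RingTheory.OrderOfVanishing.length_subquotient_map_eq_of_le`: lengths of
  subquotients `ℓ(Q/P)` (Stacks 02MF).
* `Literature.RingTheory.OrderOfVanishing.length_quotient_range_restrict_span`: Lemma A.2.6 on
  the free lattice `⊕ A bᵢ`.
* `Literature.RingTheory.OrderOfVanishing.ordFrac_det_eq_length_quotient`: Stacks 02MI / Fulton A.3.

## References

* [StacksProject] The Stacks Project, Algebra, Section 10.121: Tags 02MD, 02ME, 02MF
  (Lemma 10.121.4), 02MG, 02MI (Lemma 10.121.7), 02MJ (Lemma 10.121.8).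
* [Fulton1998] W. Fulton, *Intersection Theory*, 2nd ed., Springer (1998), Appendix A.2–A.3,
  Lemmas A.2.5, A.2.6, A.3.
-/

open Module

namespace Literature.RingTheory.OrderOfVanishing

/-! ### Subquotient lengths -/

section SubQuot

variable {A : Type*} [Ring A] {V : Type*} [AddCommGroup V] [Module A V]

/-- `ℓ(M/P) = ℓ(Q/P) + ℓ(M/Q)` for submodules `P ≤ Q ≤ M` (Stacks, Algebra, Lemma 10.121.4 (4) =
Tag 02MF (4); additivity of length on `0 → Q/P → M/P → M/Q → 0`). [cite: StacksProject, Tag 02MF] -/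
theorem length_subquotient_add {P Q M : Submodule A V} (hPQ : P ≤ Q) (hQM : Q ≤ M) :
    Module.length A (M ⧸ P.submoduleOf M) =
      Module.length A (Q ⧸ P.submoduleOf Q) + Module.length A (M ⧸ Q.submoduleOf M) := by
  have h1 : P.submoduleOf Q ≤ (P.submoduleOf M).comap (Submodule.inclusion hQM) := fun x hx ↦ hx
  have h2 : P.submoduleOf M ≤ Q.submoduleOf M := Submodule.comap_mono hPQ
  let φ : (Q ⧸ P.submoduleOf Q) →ₗ[A] (M ⧸ P.submoduleOf M) :=
    Submodule.mapQ _ _ (Submodule.inclusion hQM) h1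
  let π : (M ⧸ P.submoduleOf M) →ₗ[A] (M ⧸ Q.submoduleOf M) := Submodule.factor h2
  have hφ : Function.Injective φ := by
    rw [← LinearMap.ker_eq_bot, Submodule.ker_mapQ, ← LinearMap.le_ker_iff_map,
      Submodule.ker_mkQ]
    exact fun x hx ↦ hx
  have hπ : Function.Surjective π := Submodule.factor_surjective h2
  have hex : Function.Exact φ π := by
    rw [LinearMap.exact_iff, Submodule.ker_mapQ, Submodule.range_mapQ, Submodule.comap_id,
      Submodule.range_inclusion]
    rfl
  rw [Module.length_eq_add_of_exact φ π hφ hπ hex]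

/-- Lengths of subquotients are invariant under injective linear maps: `ℓ(ψQ/ψP) = ℓ(Q/P)`.
[folklore] -/
theorem length_subquotient_map {W : Type*} [AddCommGroup W] [Module A W] (ψ : V →ₗ[A] W)
    (hψ : Function.Injective ψ) {P Q : Submodule A V} (hPQ : P ≤ Q) :
    Module.length A (Q.map ψ ⧸ (P.map ψ).submoduleOf (Q.map ψ)) =
      Module.length A (Q ⧸ P.submoduleOf Q) := by
  have he : Submodule.map (Submodule.equivMapOfInjective ψ hψ Q).toLinearMap (P.submoduleOf Q) =
      (P.map ψ).submoduleOf (Q.map ψ) := by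
    ext ⟨y, hy⟩
    simp only [Submodule.mem_map, Submodule.submoduleOf, Submodule.mem_comap,
      Submodule.subtype_apply]
    constructor
    · rintro ⟨x, hx, hxy⟩
      refine ⟨x, hx, ?_⟩
      have h := congrArg Subtype.val hxy
      rwa [LinearEquiv.coe_toLinearMap, Submodule.coe_equivMapOfInjective_apply] at h
    · rintro ⟨x, hx, rfl⟩
      refine ⟨⟨x, hPQ hx⟩, hx, ?_⟩
      apply Subtype.ext
      rw [LinearEquiv.coe_toLinearMap, Submodule.coe_equivMapOfInjective_apply]
  rw [← (Submodule.Quotient.equiv _ _ (Submodule.equivMapOfInjective ψ hψ Q) he).length_eq]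

/-- The range of the restriction of `ψ` to an invariant submodule `M` is `ψ(M) ⊆ M`. [folklore] -/
theorem range_restrict_eq_submoduleOf (ψ : V →ₗ[A] V) {M : Submodule A V}
    (hM : ∀ x ∈ M, ψ x ∈ M) :
    LinearMap.range (ψ.restrict hM) = (M.map ψ).submoduleOf M := by
  ext ⟨x, hx⟩
  simp only [LinearMap.mem_range, Submodule.submoduleOf, Submodule.mem_comap,
    Submodule.subtype_apply, Submodule.mem_map]
  constructor
  · rintro ⟨⟨y, hy⟩, hyx⟩
    exact ⟨y, hy, by simpa [LinearMap.restrict_apply, Subtype.ext_iff] using hyx⟩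
  · rintro ⟨y, hy, rfl⟩
    exact ⟨⟨y, hy⟩, Subtype.ext (by simp [LinearMap.restrict_apply])⟩

/-- **Comparison of lattices** (Fulton, *Intersection Theory*, proof of Lemma A.3; Stacks Tag 02MF
(5)): if `F ≤ M` with `ℓ(M/F) < ∞` and `ψ` is an injective endomorphism with `ψ(F) ⊆ F`,
`ψ(M) ⊆ M`, then `ℓ(M/ψM) = ℓ(F/ψF)` (compute `ℓ(M/ψF)` through `ψF ≤ ψM ≤ M` and through
`ψF ≤ F ≤ M`, using `ψM/ψF ≅ M/F`). [cite: Fulton1998, Lemma A.3 (proof)] -/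
theorem length_subquotient_map_eq_of_le {F M : Submodule A V} (hFM : F ≤ M)
    (hfin : Module.length A (M ⧸ F.submoduleOf M) ≠ ⊤) (ψ : V →ₗ[A] V)
    (hψ : Function.Injective ψ) (hF : F.map ψ ≤ F) (hM : M.map ψ ≤ M) :
    Module.length A (M ⧸ (M.map ψ).submoduleOf M) =
      Module.length A (F ⧸ (F.map ψ).submoduleOf F) := by
  have h1 := length_subquotient_add (Submodule.map_mono hFM : F.map ψ ≤ M.map ψ) hM
  have h2 := length_subquotient_add hF hFM
  rw [length_subquotient_map ψ hψ hFM] at h1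
  rw [h1, add_comm] at h2
  exact (ENat.add_left_injective_of_ne_top hfin) h2

end SubQuot

/-! ### Finite length of torsion quotients -/

section TorsionQuot

variable {A : Type*} [CommRing A] [IsNoetherianRing A] [Ring.KrullDimLE 1 A]
  {N : Type*} [AddCommGroup N] [Module A N] [Module.Finite A N]

/-- Over a Noetherian ring of dimension `≤ 1`, a quotient of a finite module killed by a
non-zero-divisor has finite length (it is a quotient of `(A/xA)ᵏ`). [folklore] -/
theorem length_quotient_ne_top_of_smul_mem' (N' : Submodule A N) {x : A}
    (hx : x ∈ nonZeroDivisors A) (h : ∀ v : N, x • v ∈ N') :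
    Module.length A (N ⧸ N') ≠ ⊤ := by
  obtain ⟨k, π, hπ⟩ := Module.Finite.exists_fin' A N
  classical
  have hle : LinearMap.range π ≤ ⊤ := le_top
  let g : ((Fin k → A) ⧸ N'.comap π) →ₗ[A] (N ⧸ N') := Submodule.mapQ _ _ π le_rfl
  have hg : Function.Surjective g := by
    rw [← LinearMap.range_eq_top, Submodule.range_mapQ, LinearMap.range_eq_top.mpr hπ,
      Submodule.map_top, Submodule.range_mkQ]
  refine ne_top_of_le_ne_top ?_ (Module.length_le_of_surjective g hg)
  exact length_quotient_ne_top_of_smul_mem _ hx fun v ↦ by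
    change π (x • v) ∈ N'
    rw [map_smul]
    exact h (π v)

end TorsionQuot

/-! ### The free lattice spanned by a basis -/

section FreeLattice

variable {A : Type*} [CommRing A] [IsDomain A] {K : Type*} [Field K] [Algebra A K]
  [IsFractionRing A K] {V : Type*} [AddCommGroup V] [Module K V] [Module A V]
  [IsScalarTower A K V] {ι : Type*} [Fintype ι] [DecidableEq ι] (b : Basis ι K V)

variable (A) in
omit [IsDomain A] [Fintype ι] [DecidableEq ι] in
/-- A `K`-basis is `A`-linearly independent (`A ⊆ K = Frac A`). [folklore] -/
theorem linearIndependent_restrictScalars : LinearIndependent A b :=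
  b.linearIndependent.restrict_scalars fun r s h ↦ IsFractionRing.injective A K (by
    simpa only [Algebra.smul_def, mul_one] using h)

omit [IsDomain A] [DecidableEq ι] in
/-- Coordinates in the free `A`-lattice `F = ⊕ A bᵢ` spanned by a `K`-basis `b` are the
`K`-coordinates: `b.repr x i = algebraMap (repr_F x i)` for `x ∈ F`. [folklore] -/
theorem algebraMap_repr_span (x : Submodule.span A (Set.range b)) (i : ι) :
    algebraMap A K ((Basis.span (linearIndependent_restrictScalars A b)).repr x i) =
      b.repr (x : V) i := by
  set bA := Basis.span (linearIndependent_restrictScalars A b)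
  have hx : (x : V) = ∑ j, algebraMap A K (bA.repr x j) • b j := by
    conv_lhs => rw [← bA.sum_repr x]
    rw [Submodule.coe_sum]
    refine Finset.sum_congr rfl fun j _ ↦ ?_
    rw [Submodule.coe_smul, algebraMap_smul]
    congr 1
    exact congrArg Subtype.val (Basis.span_apply (linearIndependent_restrictScalars A b) j)
  have h1 : b.equivFun (x : V) = fun j ↦ algebraMap A K (bA.repr x j) := by
    rw [hx, ← Basis.equivFun_symm_apply, LinearEquiv.apply_symm_apply]
  have h2 : b.equivFun (x : V) i = algebraMap A K (bA.repr x i) := by rw [h1]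
  rw [Basis.equivFun_apply] at h2
  exact h2.symm

variable {b} in
omit [IsDomain A] in
/-- The `A`-matrix of a `K`-endomorphism `ψ` preserving the free lattice `F = ⊕ A bᵢ`, in the
basis `b`, maps to the `K`-matrix of `ψ`. [folklore] -/
theorem toMatrix_restrict_map (ψ : V →ₗ[K] V)
    (hψ : ∀ x ∈ Submodule.span A (Set.range b),
      ψ.restrictScalars A x ∈ Submodule.span A (Set.range b)) :
    (LinearMap.toMatrix (Basis.span (linearIndependent_restrictScalars A b))
        (Basis.span (linearIndependent_restrictScalars A b))
        ((ψ.restrictScalars A).restrict hψ)).map (algebraMap A K) = LinearMap.toMatrix b b ψ := by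
  ext i j
  rw [Matrix.map_apply, LinearMap.toMatrix_apply, LinearMap.toMatrix_apply, algebraMap_repr_span]
  congr 2
  rw [LinearMap.restrict_apply]
  change ψ ((Basis.span (linearIndependent_restrictScalars A b) j : _) : V) = ψ (b j)
  rw [Basis.span_apply]

variable {b} in
omit [IsDomain A] in
/-- The determinant of `ψ` restricted to the free `A`-lattice `F = ⊕ A bᵢ` is the determinant of
`ψ` (as elements of `K`). [folklore] -/
theorem algebraMap_det_restrict (ψ : V →ₗ[K] V)
    (hψ : ∀ x ∈ Submodule.span A (Set.range b),
      ψ.restrictScalars A x ∈ Submodule.span A (Set.range b)) :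
    algebraMap A K (LinearMap.det ((ψ.restrictScalars A).restrict hψ)) = LinearMap.det ψ := by
  rw [← LinearMap.det_toMatrix (Basis.span (linearIndependent_restrictScalars A b)),
    ← LinearMap.det_toMatrix b, RingHom.map_det, RingHom.mapMatrix_apply, toMatrix_restrict_map]

variable {b} in
/-- Fulton's Lemma A.2.6 on the free lattice `F = ⊕ A bᵢ`: `ℓ_A(F / ψF) = ord_A(det ψ|_F)` for a
`K`-endomorphism `ψ` with `ψ(F) ⊆ F` and `det ψ ≠ 0`. [cite: Fulton1998, Lemma A.2.6] -/
theorem length_quotient_range_restrict_span [IsNoetherianRing A] [Ring.KrullDimLE 1 A]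
    (ψ : V →ₗ[K] V)
    (hψ : ∀ x ∈ Submodule.span A (Set.range b),
      ψ.restrictScalars A x ∈ Submodule.span A (Set.range b))
    (hdet : LinearMap.det ψ ≠ 0) :
    Module.length A (Submodule.span A (Set.range b) ⧸
        LinearMap.range ((ψ.restrictScalars A).restrict hψ)) =
      Ring.ord A (LinearMap.det ((ψ.restrictScalars A).restrict hψ)) := by
  haveI := Module.Free.of_basis (Basis.span (linearIndependent_restrictScalars A b))
  haveI := Module.Finite.of_basis (Basis.span (linearIndependent_restrictScalars A b))
  refine length_quotient_range_eq_ord_det _ fun h ↦ hdet ?_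
  rw [← algebraMap_det_restrict ψ hψ, h, map_zero]

end FreeLattice

/-! ### Stacks 02MI / Fulton A.3: lattices and determinants -/

section Lattice

variable {A : Type*} [CommRing A] [IsDomain A] [IsNoetherianRing A] [Ring.KrullDimLE 1 A]
  {K : Type*} [Field K] [Algebra A K] [IsFractionRing A K]
  {V : Type*} [AddCommGroup V] [Module K V] [Module A V] [IsScalarTower A K V]
  [FiniteDimensional K V]

/-- A finitely generated `A`-submodule `M` of a `K`-vector space has `ℓ_A(M / F) < ∞` for every
submodule `F ≤ M` containing `c • M`, `c ≠ 0` (Stacks Tag 02MF (1)⇒(2)).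
[cite: StacksProject, Tag 02MF] -/
theorem length_subquotient_ne_top_of_smul_le {F M : Submodule A V} (hM : M.FG) {c : A} (hc : c ≠ 0)
    (h : ∀ m ∈ M, c • m ∈ F) : Module.length A (M ⧸ F.submoduleOf M) ≠ ⊤ := by
  haveI : Module.Finite A M := Module.Finite.iff_fg.mpr hM
  exact length_quotient_ne_top_of_smul_mem' _ (mem_nonZeroDivisors_of_ne_zero hc)
    fun m ↦ h m m.2

omit [IsDomain A] [IsNoetherianRing A] [Ring.KrullDimLE 1 A] [FiniteDimensional K V] [Module A V]
  [IsScalarTower A K V] in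
variable (K) in
/-- Nonzero elements of `A` act injectively on a `K`-vector space (`K ⊇ A = Frac`). [folklore] -/
theorem smul_injective_of_isFractionRing {c : A} (hc : c ≠ 0) (v w : V)
    (h : algebraMap A K c • v = algebraMap A K c • w) : v = w :=
  smul_right_injective V ((map_ne_zero_iff _ (IsFractionRing.injective A K)).mpr hc) h

/-- **Stacks, Algebra, Lemma 10.121.7 (Tag 02MI) / Fulton, Lemma A.3** (for lattices stable under
the endomorphism). Let `A` be a Noetherian domain of dimension `≤ 1` with fraction field `K`,
`V` a finite-dimensional `K`-vector space, `M ⊆ V` a lattice (a finitely generated `A`-submodule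
spanning `V` over `K`) and `φ : V → V` a `K`-linear map with `φ(M) ⊆ M` and `det φ ≠ 0`. Then
`ℓ_A(M / φM)` is finite and `ord_A(det φ) = ℓ_A(M / φM)`, i.e. `d(M, φM) = ord_A(det φ)`; here
`ord_A : K^* → ℤ` is Mathlib's `Ring.ordFrac A` (Stacks 02MD) with values in `ℤᵐ⁰`.
Proof (Fulton A.3): choose a `K`-basis `b` of `V` inside `M`, `F = ⊕ A bᵢ ≤ M` (so `ℓ(M/F) < ∞`)
and `a ∈ A ∖ 0` with `aφ(F) ⊆ F`; then `ℓ(M/aφM) = ℓ(F/aφF) = ord_A(det_F(aφ))` (Lemma A.2.6),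
`ℓ(M/aφM) = ℓ(M/aM) + ℓ(M/φM)`, `ℓ(M/aM) = ℓ(F/aF) = n·ord_A(a)` and
`det_F(aφ) = aⁿ det φ`. [cite: StacksProject, Tag 02MI] -/
theorem ordFrac_det_eq_length_quotient (M : Submodule A V) (hM : M.FG)
    (hMV : Submodule.span K (M : Set V) = ⊤) (φ : V →ₗ[K] V)
    (hφ : ∀ x ∈ M, φ.restrictScalars A x ∈ M) (hdet : LinearMap.det φ ≠ 0) :
    Module.length A (M ⧸ LinearMap.range ((φ.restrictScalars A).restrict hφ)) ≠ ⊤ ∧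
      Ring.ordFrac A (LinearMap.det φ) = ((Multiplicative.ofAdd
        ((Module.length A (M ⧸ LinearMap.range ((φ.restrictScalars A).restrict hφ))).toNat : ℤ) :
          Multiplicative ℤ) : WithZero (Multiplicative ℤ)) := by
  classical
  -- Step 1: a `K`-basis of `V` inside `M`
  obtain ⟨t, htM, htspan, hli⟩ := exists_linearIndependent K (M : Set V)
  have htfin : t.Finite := hli.setFinite
  haveI : Fintype t := htfin.fintype
  let b : Basis t K V := Basis.mk hli (by
    rw [Subtype.range_coe_subtype, Set.setOf_mem_eq, htspan, hMV])
  have hb : ∀ i, b i ∈ M := fun i ↦ by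
    rw [Basis.coe_mk]; exact htM i.2
  -- Step 2: the free lattice `F = ⊕ A bᵢ ≤ M`
  set F : Submodule A V := Submodule.span A (Set.range b) with hFdef
  have hFM : F ≤ M := Submodule.span_le.mpr (by rintro _ ⟨i, rfl⟩; exact hb i)
  -- Step 3: `c • M ⊆ F` for some `c ≠ 0`, so `ℓ(M/F) < ∞`
  obtain ⟨s, hs⟩ := hM
  obtain ⟨c, hc⟩ := IsLocalization.exist_integer_multiples (nonZeroDivisors A)
    (s ×ˢ (Finset.univ : Finset t)) fun p ↦ b.repr p.1 p.2
  have hcF : ∀ m ∈ M, (c : A) • m ∈ F := by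
    intro m hm
    rw [← hs] at hm
    induction hm using Submodule.span_induction with
    | mem x hx =>
      have hx' : (c : A) • x = ∑ i, ((c : A) • b.repr x i) • b i := by
        conv_lhs => rw [← b.sum_repr x]
        rw [Finset.smul_sum]
        refine Finset.sum_congr rfl fun i _ ↦ ?_
        rw [smul_assoc]
      rw [hx']
      refine Submodule.sum_mem _ fun i _ ↦ ?_
      obtain ⟨a, ha⟩ := hc (x, i) (Finset.mk_mem_product hx (Finset.mem_univ i))
      rw [← ha, algebraMap_smul]
      exact Submodule.smul_mem _ _ (Submodule.subset_span ⟨i, rfl⟩)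
    | zero => rw [smul_zero]; exact zero_mem _
    | add x y _ _ hx hy => rw [smul_add]; exact add_mem hx hy
    | smul r x _ hx => rw [smul_comm]; exact Submodule.smul_mem _ _ hx
  have hfinMF : Module.length A (M ⧸ F.submoduleOf M) ≠ ⊤ :=
    length_subquotient_ne_top_of_smul_le ⟨s, hs⟩ (nonZeroDivisors.ne_zero c.2) hcF
  -- Step 4: a denominator `a` for the matrix of `φ` in the basis `b`; `ψ = a φ`
  obtain ⟨a, ha, P, hP⟩ := exists_map_eq_smul (A := A) (LinearMap.toMatrix b b φ)
  set ψ : V →ₗ[K] V := algebraMap A K a • φ with hψdef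
  have hψmat : LinearMap.toMatrix b b ψ = P.map (algebraMap A K) := by
    rw [hψdef, LinearEquiv.map_smul, hP]
  have hψF : ∀ x ∈ F, ψ.restrictScalars A x ∈ F := by
    have hgen : ∀ j, ψ (b j) ∈ F := fun j ↦ by
      rw [← Matrix.toLin_toMatrix b b ψ, Matrix.toLin_self, hψmat]
      refine Submodule.sum_mem _ fun i _ ↦ ?_
      rw [Matrix.map_apply, algebraMap_smul]
      exact Submodule.smul_mem _ _ (Submodule.subset_span ⟨i, rfl⟩)
    intro x hx
    induction hx using Submodule.span_induction with
    | mem x hx => obtain ⟨j, rfl⟩ := hx; exact hgen j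
    | zero => rw [map_zero]; exact zero_mem _
    | add x y _ _ hx hy => rw [map_add]; exact add_mem hx hy
    | smul r x _ hx => rw [LinearMap.map_smul_of_tower]; exact Submodule.smul_mem _ _ hx
  have hψM : ∀ x ∈ M, ψ.restrictScalars A x ∈ M := fun x hx ↦ by
    rw [LinearMap.restrictScalars_apply, hψdef, LinearMap.smul_apply, algebraMap_smul]
    exact Submodule.smul_mem _ _ (hφ x hx)
  have haM : ∀ x ∈ M, (a • LinearMap.id : V →ₗ[A] V) x ∈ M := fun x hx ↦
    Submodule.smul_mem _ _ hx
  have haF : ∀ x ∈ F, (a • LinearMap.id : V →ₗ[A] V) x ∈ F := fun x hx ↦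
    Submodule.smul_mem _ _ hx
  have hdetψ : LinearMap.det ψ ≠ 0 := by
    rw [hψdef, LinearMap.det_smul]
    exact mul_ne_zero (pow_ne_zero _
      ((map_ne_zero_iff _ (IsFractionRing.injective A K)).mpr ha)) hdet
  have hψinj : Function.Injective (ψ.restrictScalars A) :=
    ((Module.End.isUnit_iff _).mp
      ((LinearMap.isUnit_iff_isUnit_det ψ).mpr (isUnit_iff_ne_zero.mpr hdetψ))).injective
  have hainj : Function.Injective (a • LinearMap.id : V →ₗ[A] V) := fun x y h ↦
    smul_injective_of_isFractionRing K ha x y (by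
      simpa only [LinearMap.smul_apply, LinearMap.id_apply, algebraMap_smul] using h)
  -- Step 5: `ℓ(M/ψM) = ℓ(F/ψF)` and `ℓ(M/aM) = ℓ(F/aF)`
  have h5 := length_subquotient_map_eq_of_le hFM hfinMF (ψ.restrictScalars A) hψinj
    (Submodule.map_le_iff_le_comap.mpr fun x hx ↦ hψF x hx)
    (Submodule.map_le_iff_le_comap.mpr fun x hx ↦ hψM x hx)
  have h5a := length_subquotient_map_eq_of_le hFM hfinMF (a • LinearMap.id : V →ₗ[A] V) hainj
    (Submodule.map_le_iff_le_comap.mpr fun x hx ↦ haF x hx)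
    (Submodule.map_le_iff_le_comap.mpr fun x hx ↦ haM x hx)
  rw [← range_restrict_eq_submoduleOf _ hψM, ← range_restrict_eq_submoduleOf _ hψF] at h5
  rw [← range_restrict_eq_submoduleOf _ haM, ← range_restrict_eq_submoduleOf _ haF] at h5a
  -- Step 6: the free lattice: `ℓ(F/ψF) = ord det_F ψ`, `ℓ(F/aF) = ord (a ^ n)`
  have h6 : Module.length A (F ⧸ LinearMap.range ((ψ.restrictScalars A).restrict hψF)) =
      Ring.ord A (LinearMap.det ((ψ.restrictScalars A).restrict hψF)) :=
    length_quotient_range_restrict_span ψ hψF hdetψ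
  haveI := Module.Free.of_basis (Basis.span (linearIndependent_restrictScalars A b))
  haveI := Module.Finite.of_basis (Basis.span (linearIndependent_restrictScalars A b))
  have hrank : Module.finrank A F = Fintype.card t :=
    Module.finrank_eq_card_basis (Basis.span (linearIndependent_restrictScalars A b))
  have haF_eq : (a • LinearMap.id : V →ₗ[A] V).restrict haF = a • LinearMap.id := by
    ext x; rfl
  have h6a : Module.length A (F ⧸ LinearMap.range ((a • LinearMap.id : V →ₗ[A] V).restrict haF)) =
      Ring.ord A (a ^ Fintype.card t) := by
    rw [haF_eq, length_quotient_range_eq_ord_det _ (by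
      rw [LinearMap.det_smul, LinearMap.det_id, mul_one]; exact pow_ne_zero _ ha),
      LinearMap.det_smul, LinearMap.det_id, mul_one, hrank]
  -- Step 7: `ℓ(M/ψM) = ℓ(M/aM) + ℓ(M/φM)`
  have hcomp : (ψ.restrictScalars A).restrict hψM =
      (a • LinearMap.id : V →ₗ[A] V).restrict haM ∘ₗ (φ.restrictScalars A).restrict hφ := by
    ext x
    simp only [LinearMap.restrict_apply, LinearMap.coe_comp, Function.comp_apply,
      LinearMap.restrictScalars_apply, hψdef, LinearMap.smul_apply, algebraMap_smul]
    rfl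
  have hainjM : Function.Injective ((a • LinearMap.id : V →ₗ[A] V).restrict haM) :=
    fun x y h ↦ Subtype.ext (hainj (congrArg Subtype.val h))
  have h7 := length_quotient_range_comp _ ((φ.restrictScalars A).restrict hφ) hainjM
  rw [← hcomp, h5, h6, h5a, h6a] at h7
  -- Step 8: finiteness
  have hdetψF : LinearMap.det ((ψ.restrictScalars A).restrict hψF) ≠ 0 := fun h ↦ hdetψ (by
    rw [← algebraMap_det_restrict ψ hψF, h, map_zero])
  have hfinψ : Ring.ord A (LinearMap.det ((ψ.restrictScalars A).restrict hψF)) ≠ ⊤ :=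
    Ring.ord_ne_top (mem_nonZeroDivisors_of_ne_zero hdetψF)
  have hfina : Ring.ord A (a ^ Fintype.card t) ≠ ⊤ :=
    Ring.ord_ne_top (mem_nonZeroDivisors_of_ne_zero (pow_ne_zero _ ha))
  have hfinφ : Module.length A (M ⧸ LinearMap.range ((φ.restrictScalars A).restrict hφ)) ≠ ⊤ := by
    intro h; rw [h, add_top] at h7; exact hfinψ h7
  refine ⟨hfinφ, ?_⟩
  -- Step 9: orders in `K`
  have hordψ : Ring.ordFrac A (LinearMap.det ψ) = ((Multiplicative.ofAdd
      ((Ring.ord A (LinearMap.det ((ψ.restrictScalars A).restrict hψF))).toNat : ℤ) :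
        Multiplicative ℤ) : WithZero (Multiplicative ℤ)) := by
    rw [← algebraMap_det_restrict ψ hψF, Ring.ordFrac_eq_ord A hdetψF,
      Ring.ordMonoidWithZeroHom_eq_coe A (mem_nonZeroDivisors_of_ne_zero hdetψF)
        (ENat.coe_toNat hfinψ).symm]
  have horda : Ring.ordFrac A (algebraMap A K a ^ Fintype.card t) = ((Multiplicative.ofAdd
      ((Ring.ord A (a ^ Fintype.card t)).toNat : ℤ) : Multiplicative ℤ) :
        WithZero (Multiplicative ℤ)) := by
    rw [← map_pow, Ring.ordFrac_eq_ord A (pow_ne_zero _ ha),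
      Ring.ordMonoidWithZeroHom_eq_coe A (mem_nonZeroDivisors_of_ne_zero (pow_ne_zero _ ha))
        (ENat.coe_toNat hfina).symm]
  have hdetψ' : LinearMap.det ψ = algebraMap A K a ^ Fintype.card t * LinearMap.det φ := by
    rw [hψdef, LinearMap.det_smul, Module.finrank_eq_card_basis b]
  rw [hdetψ', map_mul, horda, h7, ENat.toNat_add hfina hfinφ, Nat.cast_add, ofAdd_add,
    WithZero.coe_mul] at hordψ
  exact (mul_right_inj' WithZero.coe_ne_zero).mp hordψ

end Lattice

end Literature.RingTheory.OrderOfVanishing
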